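/-
Copyright (c) 2026 the pub-hodgecm-mathlib formalisation cell (harness21).  Prover seat hodgecm-mathlib-F0P3a-p04 (g31), 2026-09-03.  E1 row 41f «(SS-K) UNIFORM, GENERIC»
(E1 keeper ∕ dealer F0P3a-p03 (g29) 01:48:31Z ∕ 02:01:13Z; census row 38 `CENSUS-SSK-via-resolution.v1` a09ddab6d77c6082 §3 (A8)(A9)(A13) ∕ §5 R-f).
-/
import Literature.NumberTheory.Automorphic.SchneiderStuhlerTreeComplexSmooth   -- ★ 41f FILE B1 (this seat): smoothness of `ρ₁ ρ₀ ρV`, `trace_fixedPoints_restricted_eq_levelTrace`, `mk_mem_normalizer_subgroupOf`; brings ★ 41d I∕II, ★ TRACE-COSET, ★ 41a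
import Literature.NumberTheory.Automorphic.SchneiderStuhlerTreeComplexTrace    -- ★ 41f-(A10) (F0P3a-p02 (g28)): `trace_rep_zeroChains_eq_sum`, `trace_rep_oneChains_eq_sum` (block traces = fixed-simplex sums of `levelTrace`)
import Literature.NumberTheory.Automorphic.CompactOpenAveragingExact          -- ★ 41e (F0P2-p01): `exact_fixedPoints_of_exact`, `restrict_fixedPoints_injective`, `trace_restrict_fixedPoints_eq_averaged_trace`
import Literature.NumberTheory.Automorphic.SmoothCharacterAdditive            -- ★ `trace_eq_add_of_exact` (the (o8) pointer)
import HarnessLib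

/-!
# The Schneider–Stuhler character formula on elliptic elements, UNIFORM in the level: the Euler characteristic of `γ` on the `K`-invariants of the finite complex
# (Meyer–Solleveld 2010 Prop. 4.1; Korman 2004 §9 Claim 39 ∕ Thm 40; Schneider–Stuhler 1997 III.4.16 without Kazhdan's density theorem)

Topic `NumberTheory/Automorphic` (declarations in the `Representation` namespace, next to ★ 41d `SchneiderStuhlerTreeComplexFinite` ∕ `…Action`).  THEOREMS ONLY (no definition,
no instance, no notation, no named fact, no `sorry`).  Cell `pub/hodgecm-mathlib` (D-0151), crux H413 = `stmt-HodgeConjecture-24833`, lane `--supports`; E1 BRICK LEDGER row 41f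
(keeper F0P3a-p03 (g29)) = census row 38 §5 R-f, arrows (A8) Euler characteristic of traces, (A9) trace on invariants = averaged trace, (A13) assembly.  HONEST LABEL:
count-neutral generic base layer; E1 = PRINT until the keeper's charter test; (R-SS) NOT chartered; HC_CM is proved only modulo the 2 remaining named inputs (hLiu418 =
`stmt-HodgeConjecture-24832`, h413 = `stmt-HodgeConjecture-24833`) until rung 0 closes.

THE MATHEMATICS (census §2–§3).  `Γ` acts on the tree `G` through `a : Γ →* (G ≃g G)` with transported compact open vertex groups `U_x` ((U6)(U7), `U_{g·x} = gU_xg⁻¹`) and an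
invariant orientation; `ρ` is a smooth representation on `V`; `S ⊆ ι` is a finite root-closed vertex set stabilised by a subgroup `P`; ★ 41d gives the finite exact complex
`0 → C₁(S) →ⁱ C₀(S) →^q V|_Σ → 0` of `P`-representations `ρ₁, ρ₀, ρV`.  For `γ ∈ P` and a compact open `K ≤ P` normalised by `γ` with `V^K ≤ V|_Σ`:
(★ B1: `(V|_Σ)^K = V^K`, so `tr(γ | (V|_Σ)^K) = Θ_K(γ) := levelTrace`); (§3) the `K`-invariants of the complex are exact (★ 41e, `ρ₁, ρ₀` smooth by ★ B1) and `γ` acts on them, so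
`Θ_K(γ) = tr(γ | C₀(S)^K) − tr(γ | C₁(S)^K)` (★ `trace_eq_add_of_exact`) — for EVERY level `e` hidden in `U`: the level enters only through the hypothesis `V^K ≤ V|_Σ`
(generation, ★ 41c).  §4 (after ★ 41f-A10 «traces on `C_q(S)` = fixed-block sums», F0P3a-p02 (g28)) averages over `K` (★ 41e) and kills `K` (★ 41a + `levelTrace_mul_of_mem_right`).

* §3 `levelTrace_eq_trace_zeroChains_sub_trace_oneChains` — `Θ_K(γ) = tr(γ | C₀(S)^K) − tr(γ | C₁(S)^K)` (§1–§2 are ★ FILE B1 `SchneiderStuhlerTreeComplexSmooth`).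
* §4 `inv_card_mul_sum_eq_of_forall_eq`, `mapEdgeSet_eq_iff_head_tail_eq`, **`levelTrace_eq_fixedVertexSum_sub_fixedEdgeSum_of_blockTraces`** — the formula from the (A10)
  block-trace identities taken as hypotheses `hT0`∕`hT1`.
* §5 **`levelTrace_eq_fixedVertexSum_sub_fixedEdgeSum`** — THE HEAD: the same with `τ, τ₁, ∂, ε, ρ₁, ρ₀, ρV` obtained inside (★ 41d I∕II) and `hT0`∕`hT1` discharged by ★ 41f-(A10)
  (`trace_rep_zeroChains_eq_sum`, `trace_rep_oneChains_eq_sum`, F0P3a-p02 (g28)).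

## References
* [MeyerSolleveld2010] R. Meyer, M. Solleveld, *Resolutions for representations of reductive p-adic groups via their buildings*, J. reine angew. Math. 647 (2010): §4 Prop. 4.1.
* [Korman2004] J. Korman, *A character formula for compact elements (the rank one case)*, arXiv:math/0409292: §9 Claim 39, Theorem 40.
* [SchneiderStuhler1997] P. Schneider, U. Stuhler, *Representation theory and sheaves on the Bruhat–Tits building*, Publ. Math. IHÉS 85 (1997): Thm. III.4.16, Cor. III.4.17.
-/

set_option autoImplicit false

open scoped BigOperators Pointwise
open SimpleGraph Finset
open Literature.NumberTheory.Automorphic Literature.Combinatorics.SimpleGraph Literature.Combinatorics.SimpleGraph.OrientedIncidence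

namespace Representation

variable {k Γ V : Type*} [Field k] [CharZero k] [Group Γ] [TopologicalSpace Γ] [IsTopologicalGroup Γ]
  [AddCommGroup V] [Module k V] {ρ : Representation k Γ V}
variable {ι : Type*} [DecidableEq ι] {G : SimpleGraph ι} {a : Γ →* (G ≃g G)}

/-! ## §3 `Θ_K(γ) = tr(γ | C₀(S)^K) − tr(γ | C₁(S)^K)`: the Euler characteristic on the `K`-invariants of the exact finite complex -/

section Euler

variable (σ : Orientation G) (U : ι → Subgroup Γ) (S : Set ι)
variable {D : (G.edgeSet →₀ V) →ₗ[k] (ι →₀ V)} (hD : ∀ (c : G.edgeSet →₀ V) (u : ι), D c u = c.sum fun e m => σ.incMatrix k u e • m)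
variable {E : (ι →₀ V) →ₗ[k] V} (hE : ∀ v : ι →₀ V, E v = v.sum fun _ m => m)

include hD hE in
/-- **`Θ_K(γ) = tr(γ | C₀(S)^K) − tr(γ | C₁(S)^K)`** (census (A7)+(A8)+§2).  Inputs: the short exact sequence `0 → C₁(S) → C₀(S) → V|_Σ → 0` (★ 41d FILE I `shortExact_restrict`:
tree, (U6), (U7), `ρ` smooth, `S` root-closed), `P`-representations `ρ₁, ρ₀, ρV` intertwined by `i = D|`, `q = E|` (★ 41d FILE II letters `hiD`, `hqE`), `ρ₁, ρ₀` smooth (§1),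
`C₀(S)` finite-dimensional, a compact open `K ≤ P` normalised by `γ ∈ P` with `V^K ≤ V|_Σ`.  Then the `K ∩ P`-invariants are exact (★ 41e `exact_fixedPoints_of_exact`), `γ` acts
on the three invariant spaces compatibly, and ★ `trace_eq_add_of_exact` + §2 give the identity — for every level hidden in `U`: uniformity in `e` (Korman Thm 40) costs nothing
here. [cite: MeyerSolleveld2010, §4 Prop. 4.1] [cite: Korman2004, §9 Claim 39, Theorem 40] [cite: SchneiderStuhler1997, Thm. III.4.16] -/
theorem levelTrace_eq_trace_zeroChains_sub_trace_oneChains (hT : G.IsTree) (hU : ∀ z, IsCompact (U z : Set Γ))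
    (hU6 : ∀ x y, G.Adj x y → ((U x ⊔ U y : Subgroup Γ) : Set Γ) = (U x : Set Γ) * (U y : Set Γ))
    (hU7 : ∀ x y z, G.Adj x y → G.dist y z + 1 = G.dist x z → ((U y : Subgroup Γ) : Set Γ) ⊆ (U x : Set Γ) * (U z : Set Γ))
    (hρ : ρ.IsSmooth) {r : ι} (hSr : ∀ x ∈ S, ∀ y, G.Adj x y → G.dist r y + 1 = G.dist r x → y ∈ S)
    (hDC : ∀ c ∈ ⨆ e ∈ {e : G.edgeSet | σ.head e ∈ S ∧ σ.tail e ∈ S}, (ρ.fixedPoints (U (σ.head e) ⊔ U (σ.tail e))).map (Finsupp.lsingle e : V →ₗ[k] G.edgeSet →₀ V),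
      D c ∈ ⨆ x ∈ S, (ρ.fixedPoints (U x)).map (Finsupp.lsingle x : V →ₗ[k] ι →₀ V))
    (hEC : ∀ v ∈ ⨆ x ∈ S, (ρ.fixedPoints (U x)).map (Finsupp.lsingle x : V →ₗ[k] ι →₀ V), E v ∈ ⨆ x ∈ S, ρ.fixedPoints (U x))
    [FiniteDimensional k ↥(⨆ x ∈ S, (ρ.fixedPoints (U x)).map (Finsupp.lsingle x : V →ₗ[k] ι →₀ V))]
    {P : Subgroup Γ}
    {ρ₁ : Representation k P ↥(⨆ e ∈ {e : G.edgeSet | σ.head e ∈ S ∧ σ.tail e ∈ S}, (ρ.fixedPoints (U (σ.head e) ⊔ U (σ.tail e))).map (Finsupp.lsingle e : V →ₗ[k] G.edgeSet →₀ V))}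
    {ρ₀ : Representation k P ↥(⨆ x ∈ S, (ρ.fixedPoints (U x)).map (Finsupp.lsingle x : V →ₗ[k] ι →₀ V))}
    {ρV : Representation k P ↥(⨆ x ∈ S, ρ.fixedPoints (U x))}
    (hρV : ∀ (g : P) w, ((ρV g w : _) : V) = ρ (g : Γ) w)
    (hiD : ∀ (g : P) c, D.restrict hDC (ρ₁ g c) = ρ₀ g (D.restrict hDC c)) (hqE : ∀ (g : P) v, E.restrict hEC (ρ₀ g v) = ρV g (E.restrict hEC v))
    (hsm₁ : ρ₁.IsSmooth) (hsm₀ : ρ₀.IsSmooth)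
    {K : Subgroup Γ} (hKo : IsOpen (K : Set Γ)) (hKc : IsCompact (K : Set Γ)) (hKP : K ≤ P) {γ : Γ} (hγP : γ ∈ P)
    (hγK : γ ∈ Subgroup.normalizer (K : Set Γ)) (hKV : ρ.fixedPoints K ≤ ⨆ x ∈ S, ρ.fixedPoints (U x)) :
    ρ.levelTrace hKo hKc γ =
      LinearMap.trace k (ρ₀.fixedPoints (K.subgroupOf P))
          ((ρ₀ ⟨γ, hγP⟩).restrict (ρ₀.apply_mem_fixedPoints_of_mem_normalizer (mk_mem_normalizer_subgroupOf hγP hγK))) -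
        LinearMap.trace k (ρ₁.fixedPoints (K.subgroupOf P))
          ((ρ₁ ⟨γ, hγP⟩).restrict (ρ₁.apply_mem_fixedPoints_of_mem_normalizer (mk_mem_normalizer_subgroupOf hγP hγK))) := by
  -- the `K ∩ P`-invariants of the short exact sequence are exact
  obtain ⟨hinj, hex, hsurj⟩ := shortExact_restrict σ U S hD hE hT hU hU6 hU7 hρ hSr hDC hEC
  have hK'c : IsCompact ((K.subgroupOf P : Subgroup P) : Set P) := by
    rw [Topology.IsEmbedding.subtypeVal.isCompact_iff]
    have himg : ((↑) : P → Γ) '' ((K.subgroupOf P : Subgroup P) : Set P) = (K : Set Γ) := by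
      ext g
      constructor
      · rintro ⟨h, hh, rfl⟩
        exact Subgroup.mem_subgroupOf.1 hh
      · intro hg
        exact ⟨⟨g, hKP hg⟩, Subgroup.mem_subgroupOf.2 hg, rfl⟩
    rw [himg]
    exact hKc
  obtain ⟨hex', hsurj'⟩ := exact_fixedPoints_of_exact (K := K.subgroupOf P) hK'c hsm₁ hsm₀ (D.restrict hDC) (E.restrict hEC) hiD hqE hex hsurj
  have hinj' := restrict_fixedPoints_injective (K := K.subgroupOf P) (D.restrict hDC) hiD hinj
  -- `γ` acts on the three invariant spaces, compatibly with `i|` and `q|`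
  have hγ' := mk_mem_normalizer_subgroupOf (K := K) hγP hγK
  set K' : Subgroup P := K.subgroupOf P with hK'
  let i' : ↥(ρ₁.fixedPoints K') →ₗ[k] ↥(ρ₀.fixedPoints K') :=
    (D.restrict hDC).restrict (p := ρ₁.fixedPoints K') (q := ρ₀.fixedPoints K') (mapsTo_fixedPoints (D.restrict hDC) hiD)
  let q' : ↥(ρ₀.fixedPoints K') →ₗ[k] ↥(ρV.fixedPoints K') :=
    (E.restrict hEC).restrict (p := ρ₀.fixedPoints K') (q := ρV.fixedPoints K') (mapsTo_fixedPoints (E.restrict hEC) hqE)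
  let f : ↥(ρ₀.fixedPoints K') →ₗ[k] ↥(ρ₀.fixedPoints K') := (ρ₀ ⟨γ, hγP⟩).restrict (ρ₀.apply_mem_fixedPoints_of_mem_normalizer hγ')
  let fA : ↥(ρ₁.fixedPoints K') →ₗ[k] ↥(ρ₁.fixedPoints K') := (ρ₁ ⟨γ, hγP⟩).restrict (ρ₁.apply_mem_fixedPoints_of_mem_normalizer hγ')
  let fB : ↥(ρV.fixedPoints K') →ₗ[k] ↥(ρV.fixedPoints K') := (ρV ⟨γ, hγP⟩).restrict (ρV.apply_mem_fixedPoints_of_mem_normalizer hγ')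
  have hA : f ∘ₗ i' = i' ∘ₗ fA := by
    apply LinearMap.ext
    intro c
    apply Subtype.ext
    simp only [f, i', fA, LinearMap.comp_apply, LinearMap.restrict_apply]
    exact (hiD ⟨γ, hγP⟩ c).symm
  have hB : q' ∘ₗ f = fB ∘ₗ q' := by
    apply LinearMap.ext
    intro v
    apply Subtype.ext
    simp only [f, q', fB, LinearMap.comp_apply, LinearMap.restrict_apply]
    exact hqE ⟨γ, hγP⟩ v
  have hadd := @LinearMap.trace_eq_add_of_exact k _ (↥(ρ₁.fixedPoints K')) (↥(ρ₀.fixedPoints K')) (↥(ρV.fixedPoints K')) _ _ _ _ _ _ _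
    i' q' hinj' hsurj' hex' f fA fB hA hB
  have hB' : LinearMap.trace k _ fB = ρ.levelTrace hKo hKc γ := trace_fixedPoints_restricted_eq_levelTrace U S hρV hKo hKc hKP hγP hγK hKV
  have key : LinearMap.trace k _ f = LinearMap.trace k _ fA + ρ.levelTrace hKo hKc γ := by
    convert hadd using 2
    exact hB'.symm
  show ρ.levelTrace hKo hKc γ = LinearMap.trace k _ f - LinearMap.trace k _ fA
  rw [key]
  ring

end Euler

/-! ## §4 Averaging over `K` and killing `K`: the fixed-simplex sums (census (A9)+(A11)+(A12)+(A13)) -/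

section Assembly

variable (σ : Orientation G) (U : ι → Subgroup Γ) (S : Set ι)
variable {D : (G.edgeSet →₀ V) →ₗ[k] (ι →₀ V)} (hD : ∀ (c : G.edgeSet →₀ V) (u : ι), D c u = c.sum fun e m => σ.incMatrix k u e • m)
variable {E : (ι →₀ V) →ₗ[k] V} (hE : ∀ v : ι →₀ V, E v = v.sum fun _ m => m)

omit [TopologicalSpace Γ] [IsTopologicalGroup Γ] [DecidableEq ι] in
/-- The average of a constant family over a non-empty finite set is the constant (characteristic `0`). [cite: Korman2004, §9] -/
theorem inv_card_mul_sum_eq_of_forall_eq {β : Type*} {R : Finset β} (hR : R.Nonempty) {F : β → k} {A : k} (h : ∀ r ∈ R, F r = A) :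
    (R.card : k)⁻¹ * ∑ r ∈ R, F r = A := by
  rw [Finset.sum_congr rfl h, Finset.sum_const, nsmul_eq_mul, ← mul_assoc, inv_mul_cancel₀, one_mul]
  exact Nat.cast_ne_zero.2 (Finset.card_ne_zero.2 hR)

omit [CharZero k] [TopologicalSpace Γ] [IsTopologicalGroup Γ] [DecidableEq ι] in
/-- For an invariant orientation: `g·e = e ↔ g` fixes both ends of `e` (no inversions). [cite: SchneiderStuhler1997, Ch. II §3 p. 123] [cite: Serre1980Trees, I.3.1] -/
theorem mapEdgeSet_eq_iff_head_tail_eq (hσa : ∀ (g : Γ) (e : G.edgeSet), σ.head ((a g).mapEdgeSet e) = a g (σ.head e) ∧ σ.tail ((a g).mapEdgeSet e) = a g (σ.tail e))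
    (g : Γ) (e : G.edgeSet) : (a g).mapEdgeSet e = e ↔ a g (σ.head e) = σ.head e ∧ a g (σ.tail e) = σ.tail e := by
  constructor
  · intro h
    have h1 := (hσa g e).1
    have h2 := (hσa g e).2
    rw [h] at h1 h2
    exact ⟨h1.symm, h2.symm⟩
  · rintro ⟨hh, ht⟩
    have := FixedSetLocallyConstant.mapEdgeSet_eq_self_of_forall_apply_eq (a g : G →g G) (e := e) fun v hv => by
      rw [← σ.mk_head_tail e, Sym2.mem_iff] at hv
      rcases hv with rfl | rfl
      · exact hh
      · exact ht
    rw [Iso.mapEdgeSet_apply]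
    exact this

include hD hE in
/-- **«(SS-K) UNIFORM», assembly from the block traces** (census (A13)): given the fixed-simplex block-trace formulas for the `P`-action on `C₀(S)` and `C₁(S)` (hypotheses `hT0`,
`hT1` — the (A10) brick `trace_rep_zeroChains_eq_sum` ∕ `trace_rep_oneChains_eq_sum`), a compact open `K ≤ P` normalised by `γ ∈ P`, contained in `U_x` at every `γ`-fixed
`x ∈ S`, acting trivially on `X^γ` and its neighbours, with `V^K ≤ V|_Σ`:
`Θ_K(γ) = Σ_{x ∈ S, γx = x} Θ_{U_x}(γ) − Σ_{e ⊆ S, γe = e} Θ_{U_e}(γ)` — §3, then ★ 41e «trace on invariants = averaged trace» on `C_q(S)`, then each averaged term is the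
`r = 1` term: `Fix(γr) = Fix(γ)` (★ 41a, `G` a tree) and `Θ_{U_x}(γr) = Θ_{U_x}(γ)` (`r ∈ K ≤ U_x`, ★ `levelTrace_mul_of_mem_right`). [cite: Korman2004, §9 Claim 39, Theorem 40]
[cite: MeyerSolleveld2010, §4 Prop. 4.1] [cite: SchneiderStuhler1997, Thm. III.4.16] -/
theorem levelTrace_eq_fixedVertexSum_sub_fixedEdgeSum_of_blockTraces (hT : G.IsTree)
    (hσa : ∀ (g : Γ) (e : G.edgeSet), σ.head ((a g).mapEdgeSet e) = a g (σ.head e) ∧ σ.tail ((a g).mapEdgeSet e) = a g (σ.tail e))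
    (hUo : ∀ x, IsOpen (U x : Set Γ)) (hU : ∀ z, IsCompact (U z : Set Γ))
    (hU6 : ∀ x y, G.Adj x y → ((U x ⊔ U y : Subgroup Γ) : Set Γ) = (U x : Set Γ) * (U y : Set Γ))
    (hU7 : ∀ x y z, G.Adj x y → G.dist y z + 1 = G.dist x z → ((U y : Subgroup Γ) : Set Γ) ⊆ (U x : Set Γ) * (U z : Set Γ))
    (hEo : ∀ e : G.edgeSet, IsOpen ((U (σ.head e) ⊔ U (σ.tail e) : Subgroup Γ) : Set Γ)) (hEc : ∀ e : G.edgeSet, IsCompact ((U (σ.head e) ⊔ U (σ.tail e) : Subgroup Γ) : Set Γ))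
    (hρ : ρ.IsSmooth) (hS : S.Finite) {r : ι} (hSr : ∀ x ∈ S, ∀ y, G.Adj x y → G.dist r y + 1 = G.dist r x → y ∈ S)
    (hDC : ∀ c ∈ ⨆ e ∈ {e : G.edgeSet | σ.head e ∈ S ∧ σ.tail e ∈ S}, (ρ.fixedPoints (U (σ.head e) ⊔ U (σ.tail e))).map (Finsupp.lsingle e : V →ₗ[k] G.edgeSet →₀ V),
      D c ∈ ⨆ x ∈ S, (ρ.fixedPoints (U x)).map (Finsupp.lsingle x : V →ₗ[k] ι →₀ V))
    (hEC : ∀ v ∈ ⨆ x ∈ S, (ρ.fixedPoints (U x)).map (Finsupp.lsingle x : V →ₗ[k] ι →₀ V), E v ∈ ⨆ x ∈ S, ρ.fixedPoints (U x))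
    [FiniteDimensional k ↥(⨆ x ∈ S, (ρ.fixedPoints (U x)).map (Finsupp.lsingle x : V →ₗ[k] ι →₀ V))]
    [FiniteDimensional k ↥(⨆ e ∈ {e : G.edgeSet | σ.head e ∈ S ∧ σ.tail e ∈ S}, (ρ.fixedPoints (U (σ.head e) ⊔ U (σ.tail e))).map (Finsupp.lsingle e : V →ₗ[k] G.edgeSet →₀ V))]
    {P : Subgroup Γ}
    {ρ₁ : Representation k P ↥(⨆ e ∈ {e : G.edgeSet | σ.head e ∈ S ∧ σ.tail e ∈ S}, (ρ.fixedPoints (U (σ.head e) ⊔ U (σ.tail e))).map (Finsupp.lsingle e : V →ₗ[k] G.edgeSet →₀ V))}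
    {ρ₀ : Representation k P ↥(⨆ x ∈ S, (ρ.fixedPoints (U x)).map (Finsupp.lsingle x : V →ₗ[k] ι →₀ V))}
    {ρV : Representation k P ↥(⨆ x ∈ S, ρ.fixedPoints (U x))}
    (hρV : ∀ (g : P) w, ((ρV g w : _) : V) = ρ (g : Γ) w)
    (hiD : ∀ (g : P) c, D.restrict hDC (ρ₁ g c) = ρ₀ g (D.restrict hDC c)) (hqE : ∀ (g : P) v, E.restrict hEC (ρ₀ g v) = ρV g (E.restrict hEC v))
    (hsm₁ : ρ₁.IsSmooth) (hsm₀ : ρ₀.IsSmooth)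
    (hT0 : ∀ g : P, LinearMap.trace k _ (ρ₀ g) = ∑ x ∈ hS.toFinset with a (g : Γ) x = x, ρ.levelTrace (hUo x) (hU x) (g : Γ))
    (hT1 : ∀ g : P, LinearMap.trace k _ (ρ₁ g) =
      ∑ e ∈ (finite_edges_of_finite σ hS).toFinset with (a (g : Γ)).mapEdgeSet e = e, ρ.levelTrace (hEo e) (hEc e) (g : Γ))
    {K : Subgroup Γ} (hKo : IsOpen (K : Set Γ)) (hKc : IsCompact (K : Set Γ)) (hKP : K ≤ P) {γ : Γ} (hγP : γ ∈ P) (hne : ∃ v, a γ v = v)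
    (hγK : γ ∈ Subgroup.normalizer (K : Set Γ)) (hKU : ∀ x ∈ S, a γ x = x → K ≤ U x)
    (hKF : ∀ c ∈ K, ∀ v, a γ v = v → a c v = v) (hKN : ∀ c ∈ K, ∀ v w, a γ v = v → G.Adj v w → a c w = w)
    (hKV : ρ.fixedPoints K ≤ ⨆ x ∈ S, ρ.fixedPoints (U x)) :
    ρ.levelTrace hKo hKc γ =
      (∑ x ∈ hS.toFinset with a γ x = x, ρ.levelTrace (hUo x) (hU x) γ) -
        ∑ e ∈ (finite_edges_of_finite σ hS).toFinset with (a γ).mapEdgeSet e = e, ρ.levelTrace (hEo e) (hEc e) γ := by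
  classical
  rw [levelTrace_eq_trace_zeroChains_sub_trace_oneChains σ U S hD hE hT hU hU6 hU7 hρ hSr hDC hEC hρV hiD hqE hsm₁ hsm₀ hKo hKc hKP hγP hγK hKV]
  set K' : Subgroup P := K.subgroupOf P with hK'
  have hγ' := mk_mem_normalizer_subgroupOf (K := K) hγP hγK
  have hK'c : IsCompact ((K' : Subgroup P) : Set P) := by
    rw [Topology.IsEmbedding.subtypeVal.isCompact_iff]
    have himg : ((↑) : P → Γ) '' ((K' : Subgroup P) : Set P) = (K : Set Γ) := by
      ext g
      constructor
      · rintro ⟨h, hh, rfl⟩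
        exact Subgroup.mem_subgroupOf.1 hh
      · intro hg
        exact ⟨⟨g, hKP hg⟩, Subgroup.mem_subgroupOf.2 hg, rfl⟩
    rw [himg]
    exact hKc
  -- the vertex set fixed by `γc`, `c ∈ K`, is the one fixed by `γ` (★ 41a)
  have hfixK : ∀ c ∈ K, ∀ x, a (γ * c) x = x ↔ a γ x = x := fun c hc x =>
    Set.ext_iff.1 (FixedSetLocallyConstant.setOf_map_mul_apply_eq_eq a hT γ c hne (hKF c hc) (hKN c hc)) x
  -- §4a the `0`-chains
  have h0 : LinearMap.trace k (ρ₀.fixedPoints K') ((ρ₀ ⟨γ, hγP⟩).restrict (ρ₀.apply_mem_fixedPoints_of_mem_normalizer hγ')) =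
      ∑ x ∈ hS.toFinset with a γ x = x, ρ.levelTrace (hUo x) (hU x) γ := by
    obtain ⟨T, hTo, hTW⟩ := ρ₀.exists_isOpen_forall_apply_eq_self hsm₀
    obtain ⟨R, hR⟩ := exists_isLeftTransversal (B := K') hK'c hTo
    rw [ρ₀.trace_restrict_fixedPoints_eq_averaged_trace hK'c hTo hTW hR hγ']
    refine inv_card_mul_sum_eq_of_forall_eq hR.nonempty fun c hc => ?_
    have hcK : ((c : P) : Γ) ∈ K := Subgroup.mem_subgroupOf.1 (hR.mem_of_mem c hc)
    rw [hT0]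
    have hmul : (((⟨γ, hγP⟩ : P) * c : P) : Γ) = γ * (c : Γ) := rfl
    rw [hmul, Finset.filter_congr fun x _ => hfixK _ hcK x]
    refine Finset.sum_congr rfl fun x hx => ?_
    obtain ⟨hxS, hxfix⟩ := Finset.mem_filter.1 hx
    exact ρ.levelTrace_mul_of_mem_right (hUo x) (hU x) γ (hKU x (hS.mem_toFinset.1 hxS) hxfix hcK)
  -- §4b the `1`-chains
  have h1 : LinearMap.trace k (ρ₁.fixedPoints K') ((ρ₁ ⟨γ, hγP⟩).restrict (ρ₁.apply_mem_fixedPoints_of_mem_normalizer hγ')) =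
      ∑ e ∈ (finite_edges_of_finite σ hS).toFinset with (a γ).mapEdgeSet e = e, ρ.levelTrace (hEo e) (hEc e) γ := by
    obtain ⟨T, hTo, hTW⟩ := ρ₁.exists_isOpen_forall_apply_eq_self hsm₁
    obtain ⟨R, hR⟩ := exists_isLeftTransversal (B := K') hK'c hTo
    rw [ρ₁.trace_restrict_fixedPoints_eq_averaged_trace hK'c hTo hTW hR hγ']
    refine inv_card_mul_sum_eq_of_forall_eq hR.nonempty fun c hc => ?_
    have hcK : ((c : P) : Γ) ∈ K := Subgroup.mem_subgroupOf.1 (hR.mem_of_mem c hc)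
    rw [hT1]
    have hmul : (((⟨γ, hγP⟩ : P) * c : P) : Γ) = γ * (c : Γ) := rfl
    rw [hmul]
    have hfilt : ∀ e ∈ (finite_edges_of_finite σ hS).toFinset, (a (γ * (c : Γ))).mapEdgeSet e = e ↔ (a γ).mapEdgeSet e = e := fun e _ => by
      rw [mapEdgeSet_eq_iff_head_tail_eq σ hσa, mapEdgeSet_eq_iff_head_tail_eq σ hσa, hfixK _ hcK, hfixK _ hcK]
    rw [Finset.filter_congr hfilt]
    refine Finset.sum_congr rfl fun e he => ?_
    obtain ⟨heS, hefix⟩ := Finset.mem_filter.1 he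
    have hhead : a γ (σ.head e) = σ.head e := ((mapEdgeSet_eq_iff_head_tail_eq σ hσa γ e).1 hefix).1
    have heS' := (finite_edges_of_finite σ hS).mem_toFinset.1 heS
    exact ρ.levelTrace_mul_of_mem_right (hEo e) (hEc e) γ (Subgroup.mem_sup_left (hKU _ heS'.1 hhead hcK))
  rw [h0, h1]

end Assembly

/-! ## §5 THE HEAD: the uniform Schneider–Stuhler character formula, generic over a tree with a level-group system -/

section Head

/-- **THE SCHNEIDER–STUHLER CHARACTER FORMULA ON ELLIPTIC ELEMENTS, UNIFORM IN THE LEVEL (generic form).**  `G` a tree on `ι` with a `Γ`-action `a` by automorphisms with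
open vertex stabilisers and an invariant orientation `σ`; `U_x` compact open vertex groups with (U6), (U7) and transport `U_{g·x} = gU_xg⁻¹`; `ρ` a smooth representation of `Γ`;
`S` a finite root-closed vertex set stabilised by `P ≤ Γ` on which the `V^{U_x}` are finite-dimensional; `γ ∈ P` with a fixed vertex; `K ≤ P` compact open, normalised by `γ`,
contained in `U_x` at every `γ`-fixed `x ∈ S`, acting trivially on the `γ`-fixed vertices and their neighbours, and with `V^K ≤ V|_Σ` (the ONLY place the level enters: generation,
★ 41c).  Then  **`Θ_K(γ) = Σ_{x ∈ S, γ·x = x} Θ_{U_x}(γ) − Σ_{e ⊆ S, γ·e = e} Θ_{U_e}(γ)`**  (`Θ_K = levelTrace`; on `N(K)` it is `tr(ρ(γ) | V^K)`, ★ TRACE-COSET).  With `X^γ ⊆ S`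
and `Θ_K(γ) = Θ_π(γ)` (★ row 25 §1, HC local constancy on `γK`) this is `Θ_π(γ) = Σ_{F ⊂ X^γ} (−1)^{dim F} tr(γ | π^{U_F^{(e)}})` for every `e ≥ e₀(π)` — [SS97 III.4.16] without
Kazhdan's density theorem, [Korman2004 Thm 40] without truncation, [MS10 Prop. 4.1] on the tree.  Proof: ★ 41d I∕II supply `τ, τ₁, ∂, ε` and the `P`-representations; ★ B1 their
smoothness; ★ 41f-(A10) the block traces; §4. [cite: SchneiderStuhler1997, Thm. III.4.16] [cite: Korman2004, §9 Theorem 40] [cite: MeyerSolleveld2010, §4 Prop. 4.1] -/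
theorem levelTrace_eq_fixedVertexSum_sub_fixedEdgeSum (hT : G.IsTree) (σ : Orientation G)
    (hσa : ∀ (g : Γ) (e : G.edgeSet), σ.head ((a g).mapEdgeSet e) = a g (σ.head e) ∧ σ.tail ((a g).mapEdgeSet e) = a g (σ.tail e))
    (hstab : ∀ x : ι, IsOpen {g : Γ | a g x = x})
    (U : ι → Subgroup Γ) (hUo : ∀ x, IsOpen (U x : Set Γ)) (hU : ∀ z, IsCompact (U z : Set Γ))
    (hU6 : ∀ x y, G.Adj x y → ((U x ⊔ U y : Subgroup Γ) : Set Γ) = (U x : Set Γ) * (U y : Set Γ))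
    (hU7 : ∀ x y z, G.Adj x y → G.dist y z + 1 = G.dist x z → ((U y : Subgroup Γ) : Set Γ) ⊆ (U x : Set Γ) * (U z : Set Γ))
    (hUa : ∀ (g : Γ) (x : ι), U (a g x) = (U x).map (MulAut.conj g).toMonoidHom)
    (hEo : ∀ e : G.edgeSet, IsOpen ((U (σ.head e) ⊔ U (σ.tail e) : Subgroup Γ) : Set Γ)) (hEc : ∀ e : G.edgeSet, IsCompact ((U (σ.head e) ⊔ U (σ.tail e) : Subgroup Γ) : Set Γ))
    (hρ : ρ.IsSmooth) {S : Set ι} (hS : S.Finite) {r : ι} (hSr : ∀ x ∈ S, ∀ y, G.Adj x y → G.dist r y + 1 = G.dist r x → y ∈ S)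
    (hfd : ∀ x ∈ S, FiniteDimensional k (ρ.fixedPoints (U x)))
    {P : Subgroup Γ} (hP : ∀ g ∈ P, ∀ x, a g x ∈ S ↔ x ∈ S)
    {γ : Γ} (hγP : γ ∈ P) (hne : ∃ v, a γ v = v)
    {K : Subgroup Γ} (hKo : IsOpen (K : Set Γ)) (hKc : IsCompact (K : Set Γ)) (hKP : K ≤ P) (hγK : γ ∈ Subgroup.normalizer (K : Set Γ))
    (hKU : ∀ x ∈ S, a γ x = x → K ≤ U x) (hKF : ∀ c ∈ K, ∀ v, a γ v = v → a c v = v) (hKN : ∀ c ∈ K, ∀ v w, a γ v = v → G.Adj v w → a c w = w)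
    (hKV : ρ.fixedPoints K ≤ ⨆ x ∈ S, ρ.fixedPoints (U x)) :
    ρ.levelTrace hKo hKc γ =
      (∑ x ∈ hS.toFinset with a γ x = x, ρ.levelTrace (hUo x) (hU x) γ) -
        ∑ e ∈ (finite_edges_of_finite σ hS).toFinset with (a γ).mapEdgeSet e = e, ρ.levelTrace (hEo e) (hEc e) γ := by
  classical
  -- the chain representations and maps (★ 41d I∕II)
  obtain ⟨τ, hτ⟩ := exists_rep_zeroChains (ι := ι) (G := G) a ρ
  obtain ⟨τ₁, hτ₁⟩ := exists_rep_oneChains (G := G) a ρ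
  obtain ⟨D, hD⟩ := exists_boundaryMap (k := k) (V := V) σ
  obtain ⟨E, hE⟩ := exists_augmentationMap (k := k) (V := V) (ι := ι)
  have hDC := fun c hc => boundaryMap_mem_zeroChains (ρ := ρ) σ U S hD (c := c) hc
  have hEC := fun v hv => augmentationMap_mem_restricted (ρ := ρ) U S hE (v := v) hv
  obtain ⟨ρ₁, ρ₀, ρV, hρ₁, hρ₀, hρV, hiD, hqE⟩ := exists_reps_restrict_intertwining a σ U S hUa hσa hP hτ hτ₁ hD hE hDC hEC
  -- finite-dimensionality of `C₀(S)` and `C₁(S)`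
  haveI := finiteDimensional_zeroChains (ρ := ρ) U hS hfd
  have hfd₁ : ∀ e : G.edgeSet, σ.head e ∈ S → σ.tail e ∈ S → FiniteDimensional k (ρ.fixedPoints (U (σ.head e) ⊔ U (σ.tail e))) := fun e hh _ => by
    haveI := hfd _ hh
    exact Submodule.finiteDimensional_of_le (ρ.fixedPoints_antitone (le_sup_left : U (σ.head e) ≤ U (σ.head e) ⊔ U (σ.tail e)))
  haveI := finiteDimensional_oneChains (ρ := ρ) σ U hS hfd₁
  exact levelTrace_eq_fixedVertexSum_sub_fixedEdgeSum_of_blockTraces σ U S hD hE hT hσa hUo hU hU6 hU7 hEo hEc hρ hS hSr hDC hEC hρV hiD hqE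
    (isSmooth_rep_oneChains hτ₁ hstab σ U hUo S hρ₁) (isSmooth_rep_zeroChains hτ hstab U hUo S hρ₀)
    (fun g => trace_rep_zeroChains_eq_sum hS hfd hUo hU hUa hP hτ hρ₀ g)
    (fun g => trace_rep_oneChains_eq_sum hS hfd₁ hEo hEc hUa hσa hP hτ₁ hρ₁ g)
    hKo hKc hKP hγP hne hγK hKU hKF hKN hKV

end Head

end Representation
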